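import Mathlib
import Summits.NavierStokesRegularity.NavierStokesRegularity.Theorems.WakeRatchetTailTools
import Summits.NavierStokesRegularity.NavierStokesRegularity.Theorems.WakeRatchetRatchetStarvation
import Summits.NavierStokesRegularity.NavierStokesRegularity.Theorems.WakeRatchetTailEnvelopeFinite
import Summits.NavierStokesRegularity.NavierStokesRegularity.Theses.WakeRatchet
import HarnessLib

/-!
# `WakeRatchet.TailRatchet` (stmt-NavierStokesRegularity-21808) dominates the WHOLE bounded
# Liouville ladder: non-survival at EVERY exponent `a`, not only `a = 1`

The route's bookkeeping support `RatchetStarvation` (stmt-21810) turns the tail ratchet into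
non-survival at the exponent `a = 1` (weight `(1+ε₀)^n`), which is all the route's assembly consumes.
This file records the elementary but sharper reading: a per-shell tail contraction by a factor `1 − w`
that is UNIFORM in `ε₀ ≤ ε_s` beats the survival weight `(1+ε₀)^{a n}` of EVERY real exponent `a` as
soon as `(1+ε₀)^a (1 − w) < 1`, i.e. below an `a`-dependent threshold `ε₀ ≤ ε_a(w)`.  Hence

* `not_surviving_of_contraction` — finite tail envelopes + contraction by `1 − w` with
  `(1+ε₀)^a (1−w) < 1` ⟹ `¬ EternalSurvivingFwd a ε₀ W` (any `a : ℝ`);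
* `exists_threshold` — for `w > 0` and any `a` there is `ε_a > 0` with `(1+ε₀)^a (1−w) < 1` for all
  `ε₀ ∈ (0, ε_a]`;
* `noSurvivingEternalViscBdd_of_tailRatchet` / `noSurvivingEternalBdd_of_tailRatchet` — BY NAME,
  `TailRatchet → ∀ R ≥ 1, ∀ a, NoSurvivingEternalViscBdd R a` (and its inviscid slice
  `NoSurvivingEternalBdd R a`): the aside sits above every rung `a` of the bounded viscous/inviscid
  Liouville ladder of `Literature…BoundedEternalSolutions` (the predicates are antitone in `a`, so
  `∀ a` is the top), whereas the live rate form `TailRateRatchet` (stmt-25584, `(1+ε₀)^{-a(R)}` with a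
  FIXED `a(R) > 1`) only reaches exponents `< a(R)`.

This is negative knowledge about the STRENGTH of the aside (consistent with the standing verdict that
it is false modulo the construction `WakeRatchetDyadicFront.DyadicScalarFronts`); nothing is closed.

HONEST FRAMING: bookkeeping about bounded admissible eternal solutions of Tao-type MODEL lattice ODEs
(Tao 2016 §4, renormalised variables of §6.4); nothing here is a statement about the Navier–Stokes
equations, and no rung or summit is proved.
-/

noncomputable section

set_option linter.dupNamespace false

namespace Summit.NavierStokesRegularity.NavierStokesRegularity.Theorems

namespace WakeRatchetAllExponents

open Filter Topology
open Literature.Analysis.FluidPDE Literature.Analysis.FluidPDE.TaoCascade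
open WakeRatchetTail
open Summit.NavierStokesRegularity.NavierStokesRegularity.Theses.WakeRatchet

variable {m : ℕ} {ε₀ : ℝ} {W : ℤ → ℝ → Em m}

/-- Weight bookkeeping: the `a`-weighted renormalised shell energy of `EternalSurvivingFwd a` is
`((1+ε₀)^a)^n · E_n` (`E_n = physEnergy`), because `physWeight a ε₀ = (1+ε₀)^a Λ^{-2}` and
`E_n = Λ^{-2n} e^{2σ}‖W_n‖²` with `Λ² = (1+ε₀)^5`.
[cite: Tao2016AveragedNS, §4 Lemma 4.1 (4.8)–(4.10) in the self-similar variables of §6.4; cell vocabulary (`physWeight`, `physEnergy`)] -/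
theorem physWeight_pow_mul_eq (hε : 0 < ε₀) (a : ℝ) (n : ℕ) (σ : ℝ) :
    physWeight a ε₀ ^ n * (Real.exp (2 * σ) * ‖W n σ‖ ^ 2)
      = ((1 + ε₀) ^ a) ^ n * physEnergy ε₀ W n σ := by
  have h1 : (bigLam ε₀ ^ (n : ℤ))⁻¹ ^ 2 = (((1 + ε₀) ^ 5) ^ n)⁻¹ := by
    rw [zpow_natCast, inv_pow, ← pow_mul, mul_comm, pow_mul, bigLam_sq hε.le]
  have h2 : physWeight a ε₀ ^ n = ((1 + ε₀) ^ a) ^ n * (((1 + ε₀) ^ 5) ^ n)⁻¹ := by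
    unfold physWeight
    rw [div_pow, div_eq_mul_inv]
  unfold physEnergy
  rw [h1, h2]
  ring

/-- **Starvation at an arbitrary exponent.**  Finite tail envelopes contracting by `1 − w` per
shell with `(1+ε₀)^a (1−w) < 1` force the `a`-weighted shell energies `((1+ε₀)^a)^n E_n` to decay
geometrically in `n`, uniformly in `σ`, which is incompatible with forward `(S_a)`-survival.  The
case `a = 1` is the route item `RatchetStarvation` (stmt-21810).
[cite: Tao2016AveragedNS, §4 Thm. 4.2 (statement shape), Lemma 4.1 (4.8)–(4.10), §6.4; elementary] -/
theorem not_surviving_of_contraction {a w : ℝ} (hε : 0 < ε₀)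
    (hq : (1 + ε₀) ^ a * (1 - w) < 1) (hU : UniformBound W)
    (hEnv : ∀ n : ℤ, ∃ M : ℝ, ∀ σ : ℝ, ∑' k : ℕ, physEnergy ε₀ W (n + k) σ ≤ M)
    (hContr : ∀ (n : ℤ) (M : ℝ), (∀ σ : ℝ, ∑' k : ℕ, physEnergy ε₀ W (n + k) σ ≤ M) →
      ∀ σ : ℝ, ∑' k : ℕ, physEnergy ε₀ W (n + 1 + k) σ ≤ (1 - w) * M) :
    ¬ EternalSurvivingFwd a ε₀ W := by
  obtain ⟨Θ₀, hΘ⟩ := hEnv 0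
  have hΘ₀ : 0 ≤ Θ₀ :=
    (tsum_nonneg fun k : ℕ => physEnergy_nonneg ε₀ W ((0 : ℤ) + (k : ℤ)) 0).trans (hΘ 0)
  have hx : 0 < (1 + ε₀) ^ a := Real.rpow_pos_of_pos (by linarith) a
  set r : ℝ := max (1 - w) 0 with hr
  have hr0 : 0 ≤ r := le_max_right _ _
  set q : ℝ := (1 + ε₀) ^ a * r with hqdef
  have hq0 : 0 ≤ q := mul_nonneg hx.le hr0
  have hq1 : q < 1 := by
    rcases le_or_gt 0 (1 - w) with h | h
    · have : r = 1 - w := max_eq_left h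
      rw [hqdef, this]
      exact hq
    · have : r = 0 := max_eq_right h.le
      rw [hqdef, this, mul_zero]
      exact one_pos
  -- the `a`-weighted energies decay geometrically, uniformly in `σ`
  have hwt : ∀ (n : ℕ) (σ : ℝ),
      physWeight a ε₀ ^ n * (Real.exp (2 * σ) * ‖W n σ‖ ^ 2) ≤ q ^ n * Θ₀ := by
    intro n σ
    rw [physWeight_pow_mul_eq hε a n σ]
    have h1 : physEnergy ε₀ W n σ ≤ r ^ n * Θ₀ :=
      (physEnergy_le_tail hε hU n σ).trans (RatchetStarvation.tail_le_pow hΘ₀ hΘ hContr n σ)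
    have h2 : (0 : ℝ) ≤ ((1 + ε₀) ^ a) ^ n := pow_nonneg hx.le n
    calc ((1 + ε₀) ^ a) ^ n * physEnergy ε₀ W n σ ≤ ((1 + ε₀) ^ a) ^ n * (r ^ n * Θ₀) :=
          mul_le_mul_of_nonneg_left h1 h2
      _ = q ^ n * Θ₀ := by rw [hqdef, mul_pow]; ring
  -- survival would pin a fixed positive level at arbitrarily high shells
  rintro ⟨c, hc, hsurv⟩
  have hlim : Tendsto (fun n : ℕ => q ^ n * Θ₀) atTop (𝓝 0) := by
    simpa only [zero_mul] using (tendsto_pow_atTop_nhds_zero_of_lt_one hq0 hq1).mul_const Θ₀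
  obtain ⟨N, hN⟩ := eventually_atTop.1 (hlim.eventually (gt_mem_nhds hc))
  obtain ⟨n, hn, σ, -, hle⟩ := hsurv N
  have h2 : q ^ n * Θ₀ < c := hN n hn
  linarith [hwt n σ]

/-- **The `a`-dependent threshold.**  For `w > 0` and any real exponent `a` there is `ε_a > 0` such
that `(1+ε₀)^a (1−w) < 1` for every `ε₀ ∈ (0, ε_a]` (continuity of `ε ↦ (1+ε)^a` at `0`, where the
value is `1 − w < 1`).
[folklore] -/
theorem exists_threshold {w : ℝ} (hw : 0 < w) (a : ℝ) :
    ∃ εa : ℝ, 0 < εa ∧ ∀ ε₀ : ℝ, 0 < ε₀ → ε₀ ≤ εa → (1 + ε₀) ^ a * (1 - w) < 1 := by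
  have hcont : ContinuousAt (fun ε : ℝ => (1 + ε) ^ a * (1 - w)) 0 := by
    refine ContinuousAt.mul ?_ continuousAt_const
    refine ContinuousAt.rpow_const ?_ (Or.inl (by norm_num))
    exact (continuous_const.add continuous_id).continuousAt
  have h0 : (fun ε : ℝ => (1 + ε) ^ a * (1 - w)) 0 < 1 := by
    simp only [add_zero, Real.one_rpow, one_mul]
    linarith
  have hev : ∀ᶠ ε in 𝓝 (0 : ℝ), (1 + ε) ^ a * (1 - w) < 1 := hcont.eventually (gt_mem_nhds h0)
  obtain ⟨δ, hδ, hball⟩ := Metric.eventually_nhds_iff.1 hev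
  refine ⟨δ / 2, by linarith, fun ε₀ hε₀ hle => hball ?_⟩
  rw [Real.dist_eq, sub_zero, abs_of_pos hε₀]
  linarith

/-- **`TailRatchet` ⟹ the bounded VISCOUS Liouville predicate at EVERY exponent.**  Below the
threshold `min (ε_s(R), ε_a(w(R)))`, no uniformly bounded admissible eternal solution (any covariant
viscosity `ν̂ ≥ 0`) of an E₂(R) table is forward `(S_a)`-surviving — for every real `a`
(tail envelopes are finite by the route support `TailEnvelopeFinite`, stmt-21809).
[cite: Tao2016AveragedNS, §4 Thm. 4.2 (statement shape), Lemma 4.1 (4.8)–(4.10), §6.4; cell vocabulary (`NoSurvivingEternalViscBdd`)] -/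
theorem noSurvivingEternalViscBdd_of_tailRatchet (h : TailRatchet) {R : ℝ} (hR : 1 ≤ R) (a : ℝ) :
    NoSurvivingEternalViscBdd R a := by
  obtain ⟨w, hw, εs, hεs, H⟩ := h R hR
  obtain ⟨εa, hεa, hthr⟩ := exists_threshold hw a
  refine ⟨min εs εa, lt_min hεs hεa, fun ε₀ hε₀ hle α hα νh W hW hU => ?_⟩
  have hEnv : ∀ n : ℤ, ∃ M : ℝ, ∀ σ : ℝ, ∑' k : ℕ, physEnergy ε₀ W (n + k) σ ≤ M :=
    fun n => TailEnvelopeFinite.main hε₀ hα.2.1 hW hU n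
  exact not_surviving_of_contraction hε₀ (hthr ε₀ hε₀ (hle.trans (min_le_right _ _))) hU hEnv
    (H ε₀ hε₀ (hle.trans (min_le_left _ _)) α hα νh W hW hU)

/-- **`TailRatchet` ⟹ the bounded INVISCID Liouville predicate at EVERY exponent** (the `ν̂ = 0`
slice of `noSurvivingEternalViscBdd_of_tailRatchet`).
[cite: Tao2016AveragedNS, §4 Thm. 4.2 (statement shape), Lemma 4.1 (4.8), §6.4; cell vocabulary (`NoSurvivingEternalBdd`)] -/
theorem noSurvivingEternalBdd_of_tailRatchet (h : TailRatchet) {R : ℝ} (hR : 1 ≤ R) (a : ℝ) :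
    NoSurvivingEternalBdd R a := by
  obtain ⟨εs, hεs, H⟩ := noSurvivingEternalViscBdd_of_tailRatchet h hR a
  exact ⟨εs, hεs, fun ε₀ hε₀ hle α hα W hW hU => H ε₀ hε₀ hle α hα 0 W hW.isEternalVisc hU⟩

/-- **Packaging.**  `TailRatchet` sits above every rung of the bounded Liouville ladder: for every
spread `R ≥ 1` and EVERY exponent `a`, both `NoSurvivingEternalViscBdd R a` and
`NoSurvivingEternalBdd R a`.
[cite: Tao2016AveragedNS, §4 Thm. 4.2 (statement shape), §6.4; cell vocabulary] -/
theorem boundedLadder_all_of_tailRatchet (h : TailRatchet) :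
    ∀ R : ℝ, 1 ≤ R → ∀ a : ℝ, NoSurvivingEternalViscBdd R a ∧ NoSurvivingEternalBdd R a :=
  fun _ hR a => ⟨noSurvivingEternalViscBdd_of_tailRatchet h hR a,
    noSurvivingEternalBdd_of_tailRatchet h hR a⟩

/-- **Contrapositive (a further one-line kill criterion for the aside).**  A uniformly bounded
admissible eternal solution on a fixed-spread table that is forward `(S_a)`-surviving for SOME
exponent `a`, available at arbitrarily small `ε₀`, refutes `TailRatchet` — whatever `a` is (e.g. the
very weak survival `a = 5`, weight `Λ^{2n}`, i.e. non-decay of the renormalised energy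
`e^{2σ}‖W_n(σ)‖²` itself along a subsequence of shells).
[cite: Tao2016AveragedNS, §4 Thm. 4.2 (statement shape), §6.4; cell vocabulary] -/
theorem not_tailRatchet_of_surviving {R : ℝ} (hR : 1 ≤ R) (a : ℝ)
    (hS : ∀ ε : ℝ, 0 < ε → ∃ ε₀ : ℝ, 0 < ε₀ ∧ ε₀ ≤ ε ∧
      ∃ α : Fin 4 → Fin 4 → Fin 4 → ℤ × ℤ × ℤ → ℝ, InTableClass R α ∧
        ∃ (νh : ℝ) (W : ℤ → ℝ → Em 4), IsEternalVisc ε₀ νh α W ∧ UniformBound W ∧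
          EternalSurvivingFwd a ε₀ W) :
    ¬ TailRatchet := by
  intro h
  obtain ⟨εs, hεs, H⟩ := noSurvivingEternalViscBdd_of_tailRatchet h hR a
  obtain ⟨ε₀, hε₀, hle, α, hα, νh, W, hW, hU, hsurv⟩ := hS εs hεs
  exact H ε₀ hε₀ hle α hα νh W hW hU hsurv

end WakeRatchetAllExponents

end Summit.NavierStokesRegularity.NavierStokesRegularity.Theorems

end
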